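import Summits.NavierStokesRegularity.NavierStokesRegularity.Theses.TerminalTrace
import Literature.Analysis.FluidPDE.LocalTypeI
import Literature.Analysis.FluidPDE.KinematicApexWitness
import Literature.Analysis.FluidPDE.PotentialFlowParabolicExterior
import Literature.Analysis.FluidPDE.WeakSpatialGradientSum
import Summits.NavierStokesRegularity.NavierStokesRegularity.Theorems.TypeITraceScarL3.Negative.StubCCoreIsLocalTypeI
import Summits.NavierStokesRegularity.NavierStokesRegularity.Theorems.TypeITraceScarL3.Negative.ExteriorBUTypeIProbes
import Summits.NavierStokesRegularity.NavierStokesRegularity.Theorems.TypeITraceScarL3.Negative.ExteriorVorticityBUAbstractProbe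
import Summits.NavierStokesRegularity.NavierStokesRegularity.Theorems.TypeITraceScarL3.Negative.StubCFalseWithoutNS
import Summits.NavierStokesRegularity.NavierStokesRegularity.Theorems.TypeITraceScarL3.Negative.StubQAFalseWithoutNS
import Summits.NavierStokesRegularity.NavierStokesRegularity.Theorems.TypeITraceScarL3.Negative.C1PrimeFalseWithoutNS
import Summits.NavierStokesRegularity.NavierStokesRegularity.Theorems.TypeITraceScarL3.Negative.StubLOUDFalseWithoutNS
import Summits.NavierStokesRegularity.NavierStokesRegularity.Theorems.TypeITraceScarL3.Negative.StubQFalseWithoutNS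
import HarnessLib

/-!
# Disproof work file for crux `TypeITraceScarL3` (stmt-NavierStokesRegularity-18385) — seat cdisprove-18385 g0
# v6 (2026-08-28): sorry-free; (sw)-census witnesses for Stub C, v3 Stub QA, v3/v4 Stub LOUD (modulo QA), the
# classical vorticity cut C1′ and the NEW v4 stubs Q1 / Q234 are LANDED (§(ii-b), §(ii-c), §(ii-d), imports)

Line `apex-dichotomy` (skeleton `R25-line-apex-dichotomy.lean`, sha16 95aa062ef93d7802): after Stubs 1, 2′
(p576636, p583907), Stub B (p585263) and the composition `typeITraceScarL3_of_no_spreadExtinctApex` (p585751)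
the item IS the statement of Stub C `stub_no_spreadExtinctApex` (`StubC` below, verbatim).

## Findings (this file; kernel-checked unless marked `sorry` = near-miss, allowed only here)

(i) VACUITY of the SPREAD apex class (a suitable weak `U` with all seven clauses AND a singular origin):
    NOT KNOWN NON-EMPTY, and not constructible without settling an open problem: any member is a local
    Type-I singularity in Albritton–Barker's sense, so `¬ StubC → LocalTypeISingularityExists`
    (`localTypeISingularityExists_of_not_stubC`; A–B 2019 Thm 1.1 first bullet, OPEN; false under KNSS (L)).
    The NON-PDE clauses alone ARE jointly satisfiable by a spread, backward-singular field
    (`stub_no_spreadExtinctApex_false_without_NS`, KERNEL-CHECKED in v2: kinematic witness = self-similar bump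
    at the origin + a copy escaping to spatial infinity along `c(s) = (−s)⁻¹e` as `s → 0⁻`; `𝐈 ≤ M` on EVERY
    cylinder of the lower half-space, rate `2/√(−s)`, `|∫⟨U(s),φ⟩| ≤ 16‖φ‖_∞|B₁|(−s)`, spread, singular
    origin): Stub C is genuinely dynamical, and its renderings of `𝐈`, rate, weak-null top, spread and
    singular origin carry no hidden junk — shape (β) «marching Type-I bump» passes every non-PDE clause.
    Dead model lines (paper): columnar `v(s,r)e_θ` (2D heat, max principle ⇒ always CONFINED); Serrin/Galilean
    ghosts `b(s)`, linear flows, Beltrami, Oseen/Lamb columns, Landau, backward self-similar (violate rate / A-part /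
    unforced NS); 2D-self-similar columns (E-part diverges logarithmically).
(ii) LOAD-BEARING census of Stub C's hypotheses (sw)(G)(I)(D)(R)(T)(S):
    * drop any of (D),(R),(T),(S), or all scales `a ≠ 1` of (sw),(G),(I): witness-free unless
      `LocalTypeISingularityExists` (`localTypeISingularityExists_of_singular_apexCore`);
    * drop (I) and (G) keeping (sw),(R): still witness-free unless `LocalTypeISingularityExists`
      (rate ⇒ `𝐈 < ∞`, Albritton–Barker Lemma 2.5 = tree `albrittonBarker2019_lemma_2_5_rate`; informal here);
    * drop (sw) (the Navier–Stokes clause): FALSE (`stub_no_spreadExtinctApex_false_without_NS`, sorry-free);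
      likewise for the v3 skeleton's Stub QA (`stub_no_quietShellExtinctApex_false_without_NS`: the single
      bump is quiet on a shell of every ratio `A₀`);
    * v3's LOUD-dust stub `stub_no_loudShellExtinctApex` (the OPEN core of line `annulus-dichotomy`): drop the
      OUTER (sw), keep `hQA` verbatim ⇒ FALSE MODULO Stub QA (`stub_no_loudShellExtinctApex_false_without_NS_of_QA`);
      drop the outer (sw) AND `hQA` ⇒ FALSE outright at every ratio (`…_false_without_NS_QA`).  Witness (§(ii-c)):
      the DIVERGENCE-FREE travelling swirl `χ(‖x−c(t)‖²/(−t))/(2(−t))·J(x−c(t))` along the LOUD path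
      `‖c(t)‖ = 4√(−t)exp((−t)⁻¹(1+sin(−t)⁻¹))`, whose radius takes every value `m > 0` in every `]−δ,0[`: it
      passes (G),(I),(D),(R),(T), exceeds every `K` on every late shell of every ratio (NO quiet shell at all),
      and is singular at `0`.  (Deleting (sw) inside `hQA` as well makes LOUD vacuously true wherever the quiet
      bump fits the class — remark only.)  The other LOUD clauses: witness-free modulo `LocalTypeISingularityExists`
      exactly as for Stub C;
    * the classical vorticity cut C1′ (= `hC1` of `no_spreadExtinctApex_of_C1'`, p588275; its conclusion needs a
      CONTINUOUS DIVERGENCE-FREE representative, so the old bump witness is useless there): drop (sw) ⇒ FALSE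
      (`C1prime_false_without_NS`): the same swirl along the escaping path `c(t) = (−t)⁻¹e₀` is its own smooth
      div-free representative, SPREAD, with `curl U(s,·)(c(s))·e₂ = (−s)⁻¹ ≠ 0`, `‖c(s)‖ = (−s)⁻¹ > R` at
      arbitrarily late `s` — C1′ is genuinely the NS-specific exterior VORTICITY backward-uniqueness statement
      (`ExteriorVorticityBUTypeI`, OPEN); a proof must use that `ω = curl U` solves the vorticity equation.
    * skeleton v4 (sha16 3f7a14107033987a) splits QA into Q1 `stub_centreEnstrophyAtDepth` (singular ⇒ centre
      enstrophy `≥ κ₀T₁^{-1/2}` on `B(0,√T₁)` on an epoch at every scale) and Q234 `stub_quietShell_noConcentration`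
      (quiet shell of ratio `A₀` ⇒ no such concentration); drop (sw) from either ⇒ FALSE (§(ii-d),
      `stub_centreEnstrophyAtDepth_false_without_NS`: the LOUD swirl is singular at `0` with vorticity `≡ 0` on
      `B(0,√T₁)` for `t ≤ −T₁/4`; `stub_quietShell_noConcentration_false_without_NS`: the STATIC swirl is quiet on a
      shell of every ratio yet is the rigid rotation `Jx/(2(−t))` on `B(0,√T₁)` for `−t ≥ T₁`, centre enstrophy
      `≥ (4/9)|B₁|T₁^{-1/2}` at every scale, `κ₀ = (4/9)|B₁|`, `c₂ = 1/4`).  Both are genuinely dynamical; their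
      other clauses are witness-free modulo `LocalTypeISingularityExists` as for Stub C (Q1 additionally assumes
      the singularity, so its class minus (sw) is exactly the LOUD/SPREAD kinematic family).
    So the census is two-valued: {NS} is load-bearing outright; every other clause is load-bearing at most
    modulo the open existence of a local Type-I singularity — no `_false_without_<H>` theorem for H ≠ NS can be
    landed without DISPROVING the Liouville conjecture (L).
(iii) s25-3 TYPED (NS-specific exterior backward uniqueness with Type-I coefficients), three layers:
    * `AbstractBUTypeIZeroOrder` — the abstract parabolic-inequality form with the critical zeroth-order
      coefficient `C/(−s)`: FALSE (`abstractBUTypeIZeroOrder_false`, witness `w(s,y) = −s`): the ESS Carleman route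
      does not transfer verbatim to the vorticity equation of a Type-I apex (`|∇U| ~ C/(−s)` is critical);
    * `ExteriorVelocityBUTypeI` — velocity version on `]−1,0[ × (closedBall 0 R)ᶜ`: FALSE
      (`exteriorVelocityBUTypeI_false`, Serrin's potential flow `√(−s)∇Γ`, tree `dipoleFlow`): even an
      IRROTATIONAL exterior Type-I NS flow with weakly null top need not vanish — C1's conclusion
      («irrotational on an exterior late region», p587698) is the right target, not `U = 0`;
    * `ExteriorVorticityBUTypeI` — the vorticity version (T3-local): OPEN, typed; with «rate ⇒ classical with
      Type-I derivative bounds on exterior sub-slabs» it would give C1 of `no_spreadExtinctApex_of_C1`.  Its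
      Navier–Stokes clause is load-bearing outright: `exteriorVorticityBUTypeI_false_without_NS` (v5, kernel-checked;
      the escaping div-free swirl passes both Type-I bounds and the null top with `curl ≠ 0` beyond every radius).
NS regularity is neither proved nor refuted by anything in this file.

## HANDOFF
landed under `Theorems/TypeITraceScarL3/Negative/` (ACCEPTED): `StubCCoreIsLocalTypeI` (p588944: (ii) core —
`localTypeISingularityExists_of_singular_apexCore`, `no_spreadExtinctApex_of_not_localTypeISingularityExists`),
`ExteriorBUTypeIProbes` (p589075: (iii) — `exists_typeICoeff_parabolicIneq_nullTop_ne_zero`,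
`exists_exteriorNS_typeIRate_irrotational_nullTop_ne_zero`, `curl_dipoleFlow_eq_zero`),
`ExteriorVorticityBUAbstractProbe` (p590456: (F-a′) — the abstract exterior VORTICITY form of s25-3 fails for
`ω = √(−s)·dipole`: div-free, curl-free, decaying, `‖∂ₛω − Δω‖ = (2(−s))⁻¹‖ω‖`, null top, `ω ≠ 0`),
`StubCSpreadWitness` / `StubCSpreadWitnessTypeI` / `StubCFalseWithoutNS` (p590024 / p590768 / p591093: the
kinematic SPREAD witness, `exists_kinematic_spreadExtinctApex`), `StubQAFalseWithoutNS` (p591322: the single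
bump is quiet on every shell ratio, `exists_kinematic_quietShellExtinctApex`), `SwirlWitness` /
`SwirlWitnessTypeI` / `C1PrimeFalseWithoutNS` / `StubLOUDFalseWithoutNS` (p593093 / p593357 / p593989 / p594313: the
div-free travelling swirl along an arbitrary `C¹` path — (G),(I),(R),(T) generically; `C1prime_false_without_NS`;
`exteriorVorticityBUTypeI_false_without_NS`; `exists_loudRadius_eq`, `swirlLoud_isLoud`,
`exists_kinematic_loudShellExtinctApex`), `StubQFalseWithoutNS` (p595170: v4 stubs Q1/Q234 minus (sw) —
`curl_swirlTravel_eq_zero_of_far`, `curl_swirlVelocity_core_apply_two`, `centreEnstrophy_swirlStatic_ge`,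
`repr_eq_swirlTravel`).  Nothing is sorried.
next regimes: (β) «marching Type-I bump» as an NS ansatz (activity escaping to |y| → ∞ as s → 0⁻) — the only
shape of a spread member compatible with a bounded singular set — now known to pass every non-PDE clause, so
the equations alone must kill it (C1 / exterior vorticity backward uniqueness, `ExteriorVorticityBUTypeI`);
(α) Type-I singular dust `Σ₀ ∋ y_k → ∞`.
-/

noncomputable section

set_option linter.dupNamespace false

namespace Summit.NavierStokesRegularity.NavierStokesRegularity.Cruxes.TypeITraceScarL3.Disproof

open MeasureTheory Set Function Filter Topology Metric TopologicalSpace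
open Literature.Analysis.FluidPDE
open scoped NNReal ENNReal InnerProductSpace RealInnerProductSpace Laplacian ContDiff

/-- Local notation for physical space. -/
local notation "ℝ³" => EuclideanSpace ℝ (Fin 3)

/-! ### The target: Stub C verbatim -/

/-- Stub C `stub_no_spreadExtinctApex` of line `apex-dichotomy` (95aa062ef93d7802), VERBATIM: a SPREAD extinct
Type-I apex (clauses (sw) suitable in every `Q(a)`, (G) weak gradient, (I) `𝐈(Q(a)) ≤ M`, (D) `D ≤ D₀`,
(R) rate `C/√(−s)`, (T) weakly null top, (S) spread) is not backward singular at the origin. [folklore] -/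
def StubC : Prop :=
  ∀ (U : ℝ → ℝ³ → ℝ³) (P : ℝ → ℝ³ → ℝ) (G : ℝ → ℝ³ → ℝ³ →L[ℝ] ℝ³) (M D₀ : ℝ≥0) (C : ℝ),
    (∀ a : ℝ, 0 < a → IsSuitableWeakSolutionInBall a (0 : ℝ × ℝ³) U P) →
    (∀ a : ℝ, 0 < a → HasWeakSpatialGradientOn (parabolicCylinderOpens a (0 : ℝ × ℝ³)) U G) →
    (∀ a : ℝ, 0 < a → typeIBound (parabolicCylinder a (0 : ℝ × ℝ³)) U P G ≤ M) →
    (∀ z₀ : ℝ × ℝ³, z₀.1 ≤ 0 → ∀ r : ℝ, 0 < r → cknD r z₀ P ≤ D₀) →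
    (∀ s : ℝ, s < 0 → ∀ᵐ y : ℝ³, ‖U s y‖ ≤ C / Real.sqrt (-s)) →
    (∀ φ : ℝ³ → ℝ³, ContDiff ℝ (⊤ : ℕ∞) φ → HasCompactSupport φ → ∀ ε : ℝ, 0 < ε →
      ∃ s₀ : ℝ, s₀ < 0 ∧ ∀ᵐ s ∂(volume.restrict (Ioo s₀ 0)), |∫ y, ⟪U s y, φ y⟫| ≤ ε) →
    (∀ δ : ℝ, 0 < δ → ∀ R K : ℝ,
      ¬ (∀ᵐ z ∂(volume.restrict (Ioo (-δ) 0 ×ˢ (closedBall (0 : ℝ³) R)ᶜ)), ‖U z.1 z.2‖ ≤ K)) →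
    ¬ IsBackwardSingularPoint U (0 : ℝ × ℝ³)

/-! ### (a) Load-bearing analysis

The core clauses (sw),(G),(I) at the single scale `a = 1` plus a singular origin already constitute a local
Type-I singularity in the sense of Albritton–Barker 2019, Thm 1.1 (first bullet) — an OPEN existence question,
expected to be EMPTY under the Liouville conjecture (L) of KNSS 2009.  Hence no clause other than (sw) can be
shown load-bearing by a witness without producing such a singularity. -/

/-- **Any counterexample to the core of Stub C is a local Type-I singularity** (A–B 2019, Thm 1.1 first
bullet, with `r₀ = 1`, `z = 0`): clauses (sw),(G),(I) at scale `a = 1` and a backward-singular origin give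
`LocalTypeISingularityExists`. [cite: AlbrittonBarker2019, Thm 1.1 (first bullet), Def. 2.1] -/
theorem localTypeISingularityExists_of_singular_apexCore
    {U : ℝ → ℝ³ → ℝ³} {P : ℝ → ℝ³ → ℝ} {G : ℝ → ℝ³ → ℝ³ →L[ℝ] ℝ³} {M : ℝ≥0}
    (hsw : IsSuitableWeakSolutionInBall 1 (0 : ℝ × ℝ³) U P)
    (hG : HasWeakSpatialGradientOn (parabolicCylinderOpens 1 (0 : ℝ × ℝ³)) U G)
    (hI : typeIBound (parabolicCylinder 1 (0 : ℝ × ℝ³)) U P G ≤ M)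
    (hsing : IsBackwardSingularPoint U (0 : ℝ × ℝ³)) :
    LocalTypeISingularityExists :=
  ⟨1, 0, U, P, one_pos, hsw, hsing, G, hG, lt_of_le_of_lt hI ENNReal.coe_lt_top⟩

/-- Stub C with clauses (D),(R),(T),(S) DROPPED and (sw),(G),(I) kept at the single scale `a = 1`
(a strengthening of Stub C: fewer hypotheses). [folklore] -/
def StubCCore : Prop :=
  ∀ (U : ℝ → ℝ³ → ℝ³) (P : ℝ → ℝ³ → ℝ) (G : ℝ → ℝ³ → ℝ³ →L[ℝ] ℝ³) (M : ℝ≥0),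
    IsSuitableWeakSolutionInBall 1 (0 : ℝ × ℝ³) U P →
    HasWeakSpatialGradientOn (parabolicCylinderOpens 1 (0 : ℝ × ℝ³)) U G →
    typeIBound (parabolicCylinder 1 (0 : ℝ × ℝ³)) U P G ≤ M →
    ¬ IsBackwardSingularPoint U (0 : ℝ × ℝ³)

/-- The core implies Stub C (by weakening). [folklore] -/
theorem stubC_of_stubCCore (h : StubCCore) : StubC :=
  fun U P G M _D₀ _C hsw hG hI _hD _hR _hT _hS => h U P G M (hsw 1 one_pos) (hG 1 one_pos) (hI 1 one_pos)

/-- **Census, clauses (D),(R),(T),(S) and all scales `a ≠ 1`: witness-free modulo an open problem.**  A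
counterexample to the core (hence any counterexample to Stub C, or to Stub C with any of (D),(R),(T),(S)
dropped) yields `LocalTypeISingularityExists`. [cite: AlbrittonBarker2019, Thm 1.1 (first bullet)] -/
theorem localTypeISingularityExists_of_not_stubCCore (h : ¬ StubCCore) : LocalTypeISingularityExists := by
  by_contra hne
  refine h fun U P G M hsw hG hI hsing => hne ?_
  exact localTypeISingularityExists_of_singular_apexCore (M := M) hsw hG hI hsing

/-- In particular `¬ StubC → LocalTypeISingularityExists`: Stub C cannot be refuted short of exhibiting a local
Type-I singularity of a suitable weak solution (open; excluded by (L), cf. p585751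
`no_spreadExtinctApex_of_liouvilleConjectureNS`). [cite: AlbrittonBarker2019, Thm 1.1 (first bullet)] -/
theorem localTypeISingularityExists_of_not_stubC (h : ¬ StubC) : LocalTypeISingularityExists :=
  localTypeISingularityExists_of_not_stubCCore fun hc => h (stubC_of_stubCCore hc)

/-- Stub C with the Navier–Stokes clause (sw) DROPPED (all other six clauses kept verbatim). [folklore] -/
def StubCWithoutNS : Prop :=
  ∀ (U : ℝ → ℝ³ → ℝ³) (P : ℝ → ℝ³ → ℝ) (G : ℝ → ℝ³ → ℝ³ →L[ℝ] ℝ³) (M D₀ : ℝ≥0) (C : ℝ),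
    (∀ a : ℝ, 0 < a → HasWeakSpatialGradientOn (parabolicCylinderOpens a (0 : ℝ × ℝ³)) U G) →
    (∀ a : ℝ, 0 < a → typeIBound (parabolicCylinder a (0 : ℝ × ℝ³)) U P G ≤ M) →
    (∀ z₀ : ℝ × ℝ³, z₀.1 ≤ 0 → ∀ r : ℝ, 0 < r → cknD r z₀ P ≤ D₀) →
    (∀ s : ℝ, s < 0 → ∀ᵐ y : ℝ³, ‖U s y‖ ≤ C / Real.sqrt (-s)) →
    (∀ φ : ℝ³ → ℝ³, ContDiff ℝ (⊤ : ℕ∞) φ → HasCompactSupport φ → ∀ ε : ℝ, 0 < ε →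
      ∃ s₀ : ℝ, s₀ < 0 ∧ ∀ᵐ s ∂(volume.restrict (Ioo s₀ 0)), |∫ y, ⟪U s y, φ y⟫| ≤ ε) →
    (∀ δ : ℝ, 0 < δ → ∀ R K : ℝ,
      ¬ (∀ᵐ z ∂(volume.restrict (Ioo (-δ) 0 ×ˢ (closedBall (0 : ℝ³) R)ᶜ)), ‖U z.1 z.2‖ ≤ K)) →
    ¬ IsBackwardSingularPoint U (0 : ℝ × ℝ³)

/-! ### (ii-b) The kinematic witnesses (LANDED, sorry-free: `Negative/StubCSpreadWitness` p590024,
`Negative/StubCSpreadWitnessTypeI` p590768, `Negative/StubCFalseWithoutNS` p591093 —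
`exists_kinematic_spreadExtinctApex`; `Negative/StubQAFalseWithoutNS` p591322 —
`exists_kinematic_quietShellExtinctApex`; imported above) -/


/-- **Census, clause (sw): the Navier–Stokes clause is load-bearing OUTRIGHT (kernel-checked).**  The
kinematic field `U = V + V(·, · − c(t))`, `V = apexVelocity` (the tree's parabolic bump), `c(t) = (−t)⁻¹e`,
pressure `0`, gradient `∇V + ∇V(·, · − c(t))`, satisfies (G), (I), (D), (R) with `C = 2`, (T), (S) and is
backward singular at the origin: Stub C minus (sw) is FALSE; any proof of Stub C must use the equations /
the local energy inequality. [folklore; frame of AlbrittonBarker2019 §1] -/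
theorem stub_no_spreadExtinctApex_false_without_NS : ¬ StubCWithoutNS := by
  intro h
  obtain ⟨U, P, G, M, D₀, C, hG, hI, hD, hR, hT, hS, hsing⟩ :=
    Theorems.TypeITraceScarL3.Negative.exists_kinematic_spreadExtinctApex
  exact h U P G M D₀ C hG hI hD hR hT hS hsing

/-- Stub QA `stub_no_quietShellExtinctApex` of the REGISTERED skeleton v3 (`R26-line-annulus-dichotomy.lean`,
sha16 a0af4d6cb8b072dd) with its Navier–Stokes clause `(sw)` dropped (all other clauses verbatim). -/
def StubQAWithoutNS : Prop :=
  ∀ (M D₀ : ℝ≥0) (C : ℝ), ∃ A₀ : ℝ, 1 < A₀ ∧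
    ∀ (U : ℝ → ℝ³ → ℝ³) (P : ℝ → ℝ³ → ℝ) (G : ℝ → ℝ³ → ℝ³ →L[ℝ] ℝ³),
      (∀ a : ℝ, 0 < a → HasWeakSpatialGradientOn (parabolicCylinderOpens a (0 : ℝ × ℝ³)) U G) →
      (∀ a : ℝ, 0 < a → typeIBound (parabolicCylinder a (0 : ℝ × ℝ³)) U P G ≤ M) →
      (∀ z₀ : ℝ × ℝ³, z₀.1 ≤ 0 → ∀ r : ℝ, 0 < r → cknD r z₀ P ≤ D₀) →
      (∀ s : ℝ, s < 0 → ∀ᵐ y : ℝ³, ‖U s y‖ ≤ C / Real.sqrt (-s)) →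
      (∀ φ : ℝ³ → ℝ³, ContDiff ℝ (⊤ : ℕ∞) φ → HasCompactSupport φ → ∀ ε : ℝ, 0 < ε →
        ∃ s₀ : ℝ, s₀ < 0 ∧ ∀ᵐ s ∂(volume.restrict (Ioo s₀ 0)), |∫ y, ⟪U s y, φ y⟫| ≤ ε) →
      (∃ δ : ℝ, 0 < δ ∧ ∃ R : ℝ, 0 < R ∧ ∃ K : ℝ,
        ∀ᵐ z ∂(volume.restrict (Ioo (-δ) 0 ×ˢ {y : ℝ³ | R < ‖y‖ ∧ ‖y‖ < A₀ * R})), ‖U z.1 z.2‖ ≤ K) →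
      ¬ IsBackwardSingularPoint U (0 : ℝ × ℝ³)

/-- **Census for the v3 skeleton's Stub QA: (sw) is load-bearing OUTRIGHT there too (kernel-checked).**  The
single bump `V = apexVelocity`, `P = 0`, `G = apexGradient` passes (G), (I), (D), (R) (`C = 1`), (T), is QUIET
on the shell `]−1/16,0[ × {1/2 < ‖y‖ < A₀/2}` for every ratio `A₀`, and is backward singular at the origin
(`Theorems.TypeITraceScarL3.Negative.exists_kinematic_quietShellExtinctApex`). [folklore; frame of AlbrittonBarker2019 §1] -/
theorem stub_no_quietShellExtinctApex_false_without_NS : ¬ StubQAWithoutNS := by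
  intro h
  obtain ⟨M, D₀, C, hw⟩ := Theorems.TypeITraceScarL3.Negative.exists_kinematic_quietShellExtinctApex
  obtain ⟨A₀, -, hA⟩ := h M D₀ C
  obtain ⟨U, P, G, hG, hI, hD, hR, hT, hQ, hsing⟩ := hw A₀
  exact hA U P G hG hI hD hR hT hQ hsing

/-! ### (ii-c) ROUND-26 line `annulus-dichotomy` (skeleton v3, sha16 a0af4d6cb8b072dd): the LOUD-dust stub,
and the classical vorticity cut C1′ (`no_spreadExtinctApex_of_C1'`, p588275) — census of the Navier–Stokes
clause (LANDED, sorry-free: `Negative/SwirlWitness`, `Negative/SwirlWitnessTypeI`,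
`Negative/C1PrimeFalseWithoutNS`, `Negative/StubLOUDFalseWithoutNS` — the divergence-free TRAVELLING SWIRL
`U(t,x) = S(t, x − c(t))`, `S(t,x) = χ(‖x‖²/(−t))/(2(−t))·Jx`, along the SPREAD path `c(t) = (−t)⁻¹e₀`,
resp. the LOUD path `c(t) = 4√(−t)·exp((−t)⁻¹(1 + sin (−t)⁻¹))e₀` whose radius takes every positive value
at arbitrarily late times) -/

/-- Stub QA `stub_no_quietShellExtinctApex` of skeleton v3, VERBATIM (with its Navier–Stokes clause). -/
def StubQA : Prop :=
  ∀ (M D₀ : ℝ≥0) (C : ℝ), ∃ A₀ : ℝ, 1 < A₀ ∧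
    ∀ (U : ℝ → ℝ³ → ℝ³) (P : ℝ → ℝ³ → ℝ) (G : ℝ → ℝ³ → ℝ³ →L[ℝ] ℝ³),
      (∀ a : ℝ, 0 < a → IsSuitableWeakSolutionInBall a (0 : ℝ × ℝ³) U P) →
      (∀ a : ℝ, 0 < a → HasWeakSpatialGradientOn (parabolicCylinderOpens a (0 : ℝ × ℝ³)) U G) →
      (∀ a : ℝ, 0 < a → typeIBound (parabolicCylinder a (0 : ℝ × ℝ³)) U P G ≤ M) →
      (∀ z₀ : ℝ × ℝ³, z₀.1 ≤ 0 → ∀ r : ℝ, 0 < r → cknD r z₀ P ≤ D₀) →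
      (∀ s : ℝ, s < 0 → ∀ᵐ y : ℝ³, ‖U s y‖ ≤ C / Real.sqrt (-s)) →
      (∀ φ : ℝ³ → ℝ³, ContDiff ℝ (⊤ : ℕ∞) φ → HasCompactSupport φ → ∀ ε : ℝ, 0 < ε →
        ∃ s₀ : ℝ, s₀ < 0 ∧ ∀ᵐ s ∂(volume.restrict (Ioo s₀ 0)), |∫ y, ⟪U s y, φ y⟫| ≤ ε) →
      (∃ δ : ℝ, 0 < δ ∧ ∃ R : ℝ, 0 < R ∧ ∃ K : ℝ,
        ∀ᵐ z ∂(volume.restrict (Ioo (-δ) 0 ×ˢ {y : ℝ³ | R < ‖y‖ ∧ ‖y‖ < A₀ * R})), ‖U z.1 z.2‖ ≤ K) →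
      ¬ IsBackwardSingularPoint U (0 : ℝ × ℝ³)

/-- Stub LOUD `stub_no_loudShellExtinctApex` of skeleton v3 with the Navier–Stokes clause (sw) of the OUTER
package dropped; its quiet-shell hypothesis `hQA` is kept VERBATIM (including `hQA`'s own (sw)). -/
def StubLOUDWithoutNS : Prop :=
  ∀ (M D₀ : ℝ≥0) (C A₀ : ℝ), 1 < A₀ →
    (∀ (U : ℝ → ℝ³ → ℝ³) (P : ℝ → ℝ³ → ℝ) (G : ℝ → ℝ³ → ℝ³ →L[ℝ] ℝ³),
      (∀ a : ℝ, 0 < a → IsSuitableWeakSolutionInBall a (0 : ℝ × ℝ³) U P) →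
      (∀ a : ℝ, 0 < a → HasWeakSpatialGradientOn (parabolicCylinderOpens a (0 : ℝ × ℝ³)) U G) →
      (∀ a : ℝ, 0 < a → typeIBound (parabolicCylinder a (0 : ℝ × ℝ³)) U P G ≤ M) →
      (∀ z₀ : ℝ × ℝ³, z₀.1 ≤ 0 → ∀ r : ℝ, 0 < r → cknD r z₀ P ≤ D₀) →
      (∀ s : ℝ, s < 0 → ∀ᵐ y : ℝ³, ‖U s y‖ ≤ C / Real.sqrt (-s)) →
      (∀ φ : ℝ³ → ℝ³, ContDiff ℝ (⊤ : ℕ∞) φ → HasCompactSupport φ → ∀ ε : ℝ, 0 < ε →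
        ∃ s₀ : ℝ, s₀ < 0 ∧ ∀ᵐ s ∂(volume.restrict (Ioo s₀ 0)), |∫ y, ⟪U s y, φ y⟫| ≤ ε) →
      (∃ δ : ℝ, 0 < δ ∧ ∃ R : ℝ, 0 < R ∧ ∃ K : ℝ,
        ∀ᵐ z ∂(volume.restrict (Ioo (-δ) 0 ×ˢ {y : ℝ³ | R < ‖y‖ ∧ ‖y‖ < A₀ * R})), ‖U z.1 z.2‖ ≤ K) →
      ¬ IsBackwardSingularPoint U (0 : ℝ × ℝ³)) →
    ∀ (U : ℝ → ℝ³ → ℝ³) (P : ℝ → ℝ³ → ℝ) (G : ℝ → ℝ³ → ℝ³ →L[ℝ] ℝ³),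
      (∀ a : ℝ, 0 < a → HasWeakSpatialGradientOn (parabolicCylinderOpens a (0 : ℝ × ℝ³)) U G) →
      (∀ a : ℝ, 0 < a → typeIBound (parabolicCylinder a (0 : ℝ × ℝ³)) U P G ≤ M) →
      (∀ z₀ : ℝ × ℝ³, z₀.1 ≤ 0 → ∀ r : ℝ, 0 < r → cknD r z₀ P ≤ D₀) →
      (∀ s : ℝ, s < 0 → ∀ᵐ y : ℝ³, ‖U s y‖ ≤ C / Real.sqrt (-s)) →
      (∀ φ : ℝ³ → ℝ³, ContDiff ℝ (⊤ : ℕ∞) φ → HasCompactSupport φ → ∀ ε : ℝ, 0 < ε →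
        ∃ s₀ : ℝ, s₀ < 0 ∧ ∀ᵐ s ∂(volume.restrict (Ioo s₀ 0)), |∫ y, ⟪U s y, φ y⟫| ≤ ε) →
      (¬ ∃ δ : ℝ, 0 < δ ∧ ∃ R : ℝ, 0 < R ∧ ∃ K : ℝ,
        ∀ᵐ z ∂(volume.restrict (Ioo (-δ) 0 ×ˢ {y : ℝ³ | R < ‖y‖ ∧ ‖y‖ < A₀ * R})), ‖U z.1 z.2‖ ≤ K) →
      ¬ IsBackwardSingularPoint U (0 : ℝ × ℝ³)

/-- **Census for the v3 LOUD-dust stub: the OUTER Navier–Stokes clause is load-bearing, modulo Stub QA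
(kernel-checked).**  If the quiet-shell exclusion QA holds (so that `hQA` is available at the witness's class
`(M, 0, 1)` for some ratio `A₀ > 1`), the LOUD stub minus its outer (sw) is FALSE: the divergence-free
travelling swirl along the loud path passes (G), (I), (D), (R), (T), has NO quiet shell of ANY ratio, and is
backward singular at the origin (`Theorems.TypeITraceScarL3.Negative.exists_kinematic_loudShellExtinctApex`).
So any proof of LOUD must use the equations on the loud package itself, not only through `hQA`.  (Remark, not
formalised: deleting (sw) ALSO inside `hQA` makes the stub vacuously true at every class containing the quiet
bump of `StubQAFalseWithoutNS`, since that `hQA` is then false.) [folklore; frame of AlbrittonBarker2019 §1] -/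
theorem stub_no_loudShellExtinctApex_false_without_NS_of_QA (hQA : StubQA) : ¬ StubLOUDWithoutNS := by
  intro h
  obtain ⟨U, P, G, M, D₀, C, hG, hI, hD, hR, hT, hL, hsing, -⟩ :=
    Theorems.TypeITraceScarL3.Negative.exists_kinematic_loudShellExtinctApex
  obtain ⟨A₀, hA, hQ⟩ := hQA M D₀ C
  exact h M D₀ C A₀ hA hQ U P G hG hI hD hR hT (hL A₀ hA) hsing

/-- Stub LOUD with BOTH the outer Navier–Stokes clause and the quiet-shell hypothesis `hQA` dropped. -/
def StubLOUDWithoutNSQA : Prop :=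
  ∀ (M D₀ : ℝ≥0) (C A₀ : ℝ), 1 < A₀ →
    ∀ (U : ℝ → ℝ³ → ℝ³) (P : ℝ → ℝ³ → ℝ) (G : ℝ → ℝ³ → ℝ³ →L[ℝ] ℝ³),
      (∀ a : ℝ, 0 < a → HasWeakSpatialGradientOn (parabolicCylinderOpens a (0 : ℝ × ℝ³)) U G) →
      (∀ a : ℝ, 0 < a → typeIBound (parabolicCylinder a (0 : ℝ × ℝ³)) U P G ≤ M) →
      (∀ z₀ : ℝ × ℝ³, z₀.1 ≤ 0 → ∀ r : ℝ, 0 < r → cknD r z₀ P ≤ D₀) →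
      (∀ s : ℝ, s < 0 → ∀ᵐ y : ℝ³, ‖U s y‖ ≤ C / Real.sqrt (-s)) →
      (∀ φ : ℝ³ → ℝ³, ContDiff ℝ (⊤ : ℕ∞) φ → HasCompactSupport φ → ∀ ε : ℝ, 0 < ε →
        ∃ s₀ : ℝ, s₀ < 0 ∧ ∀ᵐ s ∂(volume.restrict (Ioo s₀ 0)), |∫ y, ⟪U s y, φ y⟫| ≤ ε) →
      (¬ ∃ δ : ℝ, 0 < δ ∧ ∃ R : ℝ, 0 < R ∧ ∃ K : ℝ,
        ∀ᵐ z ∂(volume.restrict (Ioo (-δ) 0 ×ˢ {y : ℝ³ | R < ‖y‖ ∧ ‖y‖ < A₀ * R})), ‖U z.1 z.2‖ ≤ K) →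
      ¬ IsBackwardSingularPoint U (0 : ℝ × ℝ³)

/-- **… and unconditionally once `hQA` is dropped too**: «a LOUD extinct Type-I apex (kinematic clauses only)
is not singular» is FALSE at every ratio `A₀ > 1`. [folklore; frame of AlbrittonBarker2019 §1] -/
theorem stub_no_loudShellExtinctApex_false_without_NS_QA : ¬ StubLOUDWithoutNSQA := by
  intro h
  obtain ⟨U, P, G, M, D₀, C, hG, hI, hD, hR, hT, hL, hsing, -⟩ :=
    Theorems.TypeITraceScarL3.Negative.exists_kinematic_loudShellExtinctApex
  exact h M D₀ C 2 one_lt_two U P G hG hI hD hR hT (hL 2 one_lt_two) hsing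

/-- The hypothesis `hC1` (= C1′, exterior irrotationality of late continuous divergence-free strip
representatives of SPREAD packages) of `Theorems.TypeITraceScarL3.no_spreadExtinctApex_of_C1'` (p588275) with
its Navier–Stokes clause (sw) dropped, all other clauses verbatim. -/
def C1primeWithoutNS : Prop :=
  ∀ (U : ℝ → ℝ³ → ℝ³) (P : ℝ → ℝ³ → ℝ) (G : ℝ → ℝ³ → ℝ³ →L[ℝ] ℝ³) (M D₀ : ℝ≥0) (C : ℝ),
    (∀ a : ℝ, 0 < a → HasWeakSpatialGradientOn (parabolicCylinderOpens a (0 : ℝ × ℝ³)) U G) →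
    (∀ a : ℝ, 0 < a → typeIBound (parabolicCylinder a (0 : ℝ × ℝ³)) U P G ≤ M) →
    (∀ z₀ : ℝ × ℝ³, z₀.1 ≤ 0 → ∀ r : ℝ, 0 < r → cknD r z₀ P ≤ D₀) →
    (∀ s : ℝ, s < 0 → ∀ᵐ y : ℝ³, ‖U s y‖ ≤ C / Real.sqrt (-s)) →
    (∀ φ : ℝ³ → ℝ³, ContDiff ℝ (⊤ : ℕ∞) φ → HasCompactSupport φ → ∀ ε : ℝ, 0 < ε →
      ∃ s₀ : ℝ, s₀ < 0 ∧ ∀ᵐ s ∂(volume.restrict (Ioo s₀ 0)), |∫ y, ⟪U s y, φ y⟫| ≤ ε) →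
    (∀ δ : ℝ, 0 < δ → ∀ R K : ℝ,
      ¬ (∀ᵐ z ∂(volume.restrict (Ioo (-δ) 0 ×ˢ (closedBall (0 : ℝ³) R)ᶜ)), ‖U z.1 z.2‖ ≤ K)) →
    ∃ δ : ℝ, 0 < δ ∧ ∃ R : ℝ, 0 < R ∧ ∀ ε : ℝ, 0 < ε → ε < δ →
      ∀ V : ℝ → ℝ³ → ℝ³,
        uncurry V =ᵐ[volume.restrict (Ioo (-δ) (-ε) ×ˢ (univ : Set ℝ³))] uncurry U →
        ContinuousOn (uncurry V) (Ioo (-δ) (-ε) ×ˢ (univ : Set ℝ³)) →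
        (∀ z ∈ Ioo (-δ) (-ε) ×ˢ (univ : Set ℝ³), ContDiffAt ℝ (⊤ : ℕ∞) (V z.1) z.2) →
        (∀ z ∈ Ioo (-δ) (-ε) ×ˢ (univ : Set ℝ³), VectorCalculus.divergence (V z.1) z.2 = 0) →
        ∀ s ∈ Ioo (-δ) (-ε), ∀ x : ℝ³, R < ‖x‖ → curl (V s) x = 0

/-- **Census for C1′: the Navier–Stokes clause is load-bearing OUTRIGHT (kernel-checked).**  The
divergence-free travelling swirl along the escaping path `c(t) = (−t)⁻¹e₀` passes (G), (I), (D), (R) (`C = 1`),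
(T), is SPREAD, is its own jointly continuous representative with `C^∞` divergence-free slices, and
`(curl U(s,·))(c(s))·e₂ = (−s)⁻¹ ≠ 0` with `‖c(s)‖ = (−s)⁻¹ > R` at arbitrarily late `s`: C1′ minus (sw) is
FALSE, so C1′ is a genuinely dynamical statement (exterior backward uniqueness for the VORTICITY equation with
Type-I coefficients — any proof must use `ω = curl U` solving it, cf. `ExteriorVorticityBUTypeI` below).
[folklore; EscauriazaSereginSverak2003 §3–§5] -/
theorem C1prime_false_without_NS : ¬ C1primeWithoutNS :=
  Theorems.TypeITraceScarL3.Negative.C1prime_false_without_NS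

/-! ### (ii-d) ROUND-26 line `annulus-dichotomy`, skeleton v4 (sha16 3f7a14107033987a): the NEW stubs
Q1 `stub_centreEnstrophyAtDepth` and Q234 `stub_quietShell_noConcentration` minus their Navier–Stokes clause
are FALSE (kinematic counter-models LANDED: `Negative/StubQFalseWithoutNS`, p595170) -/

/-- The centre-enstrophy conclusion shared by Q1 and Q234 (v4, verbatim): at every scale `T₁` there is an epoch
`[t₁ − c₂T₁, t₁]`, `t₁ ∈ [−T₁, −T₁/2]`, on which every continuous `C¹`-sliced representative `V` of `U` on the
depth slab `]−2T₁, −T₁/4[ × ℝ³` has `∫_{B(0,√T₁)} ‖curl V(t)‖² ≥ κ₀ T₁^{-1/2}`. -/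
def CentreEnstrophyAtDepth (κ₀ c₂ : ℝ) (U : ℝ → ℝ³ → ℝ³) : Prop :=
  ∀ T₁ : ℝ, 0 < T₁ → ∃ t₁ ∈ Icc (-T₁) (-T₁ / 2),
    ∀ V : ℝ → ℝ³ → ℝ³,
      Function.uncurry V =ᵐ[volume.restrict (Ioo (-2 * T₁) (-T₁ / 4) ×ˢ (univ : Set ℝ³))]
        Function.uncurry U →
      ContinuousOn (Function.uncurry V) (Ioo (-2 * T₁) (-T₁ / 4) ×ˢ (univ : Set ℝ³)) →
      (∀ t ∈ Ioo (-2 * T₁) (-T₁ / 4), ContDiff ℝ 1 (V t)) →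
      ∀ t ∈ Icc (t₁ - c₂ * T₁) t₁,
        κ₀ * T₁ ^ (-(1 / 2 : ℝ)) ≤ ∫ x in ball (0 : ℝ³) (Real.sqrt T₁), ‖curl (V t) x‖ ^ 2

/-- Q1 `stub_centreEnstrophyAtDepth` (v4 l.161) with its Navier–Stokes clause (sw) dropped, all else verbatim. -/
def StubQ1WithoutNS : Prop :=
  ∀ (M D₀ : ℝ≥0) (C : ℝ), ∃ κ₀ : ℝ, 0 < κ₀ ∧ ∃ c₂ : ℝ, 0 < c₂ ∧ c₂ < 1 / 2 ∧
    ∀ (U : ℝ → ℝ³ → ℝ³) (P : ℝ → ℝ³ → ℝ) (G : ℝ → ℝ³ → ℝ³ →L[ℝ] ℝ³),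
      (∀ a : ℝ, 0 < a → HasWeakSpatialGradientOn (parabolicCylinderOpens a (0 : ℝ × ℝ³)) U G) →
      (∀ a : ℝ, 0 < a → typeIBound (parabolicCylinder a (0 : ℝ × ℝ³)) U P G ≤ M) →
      (∀ z₀ : ℝ × ℝ³, z₀.1 ≤ 0 → ∀ r : ℝ, 0 < r → cknD r z₀ P ≤ D₀) →
      (∀ s : ℝ, s < 0 → ∀ᵐ y : ℝ³, ‖U s y‖ ≤ C / Real.sqrt (-s)) →
      (∀ φ : ℝ³ → ℝ³, ContDiff ℝ (⊤ : ℕ∞) φ → HasCompactSupport φ → ∀ ε : ℝ, 0 < ε →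
        ∃ s₀ : ℝ, s₀ < 0 ∧ ∀ᵐ s ∂(volume.restrict (Ioo s₀ 0)), |∫ y, ⟪U s y, φ y⟫| ≤ ε) →
      IsBackwardSingularPoint U (0 : ℝ × ℝ³) →
      CentreEnstrophyAtDepth κ₀ c₂ U

/-- **Census for Q1: the Navier–Stokes clause is load-bearing OUTRIGHT (kernel-checked).**  The loud travelling
swirl is singular at the origin, passes (G),(I),(D),(R),(T), and has vorticity `≡ 0` on `B(0,1)` at all
`t ≤ −1/4` (its support `B(c(t),2√(−t))` stays at distance `≥ 2√(−t)`): the centre enstrophy is `0 < κ₀` —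
singularity alone forces no enstrophy at depth under the apex. [folklore; frame of AlbrittonBarker2019 §1] -/
theorem stub_centreEnstrophyAtDepth_false_without_NS : ¬ StubQ1WithoutNS :=
  Theorems.TypeITraceScarL3.Negative.stub_centreEnstrophyAtDepth_false_without_NS

/-- Q234 `stub_quietShell_noConcentration` (v4 l.212) with its Navier–Stokes clause (sw) dropped, all else
verbatim. -/
def StubQ234WithoutNS : Prop :=
  ∀ (M D₀ : ℝ≥0) (C κ₀ c₂ : ℝ), 0 < κ₀ → 0 < c₂ → c₂ < 1 / 2 → ∃ A₀ : ℝ, 1 < A₀ ∧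
    ∀ (U : ℝ → ℝ³ → ℝ³) (P : ℝ → ℝ³ → ℝ) (G : ℝ → ℝ³ → ℝ³ →L[ℝ] ℝ³),
      (∀ a : ℝ, 0 < a → HasWeakSpatialGradientOn (parabolicCylinderOpens a (0 : ℝ × ℝ³)) U G) →
      (∀ a : ℝ, 0 < a → typeIBound (parabolicCylinder a (0 : ℝ × ℝ³)) U P G ≤ M) →
      (∀ z₀ : ℝ × ℝ³, z₀.1 ≤ 0 → ∀ r : ℝ, 0 < r → cknD r z₀ P ≤ D₀) →
      (∀ s : ℝ, s < 0 → ∀ᵐ y : ℝ³, ‖U s y‖ ≤ C / Real.sqrt (-s)) →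
      (∀ φ : ℝ³ → ℝ³, ContDiff ℝ (⊤ : ℕ∞) φ → HasCompactSupport φ → ∀ ε : ℝ, 0 < ε →
        ∃ s₀ : ℝ, s₀ < 0 ∧ ∀ᵐ s ∂(volume.restrict (Ioo s₀ 0)), |∫ y, ⟪U s y, φ y⟫| ≤ ε) →
      (∃ δ : ℝ, 0 < δ ∧ ∃ R : ℝ, 0 < R ∧ ∃ K : ℝ,
        ∀ᵐ z ∂(volume.restrict (Ioo (-δ) 0 ×ˢ {y : ℝ³ | R < ‖y‖ ∧ ‖y‖ < A₀ * R})), ‖U z.1 z.2‖ ≤ K) →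
      ¬ CentreEnstrophyAtDepth κ₀ c₂ U

/-- **Census for Q234: the Navier–Stokes clause is load-bearing OUTRIGHT (kernel-checked).**  At
`κ₀ = (4/9)|B₁|`, `c₂ = 1/4` and EVERY ratio `A₀ > 1` the static swirl passes (G),(I),(D),(R),(T), is QUIET on
`]−1/16,0[ × {1 < ‖y‖ < A₀}`, and carries centre enstrophy `≥ κ₀T₁^{-1/2}` on `B(0,√T₁)` throughout
`[−5T₁/4, −T₁]` at every scale (it is `Jx/(2(−t))` there, vorticity `(−t)⁻¹e₂`).  So Q234 is genuinely the
Carleman statement of the line (Tao 2019 §5): any proof must use the equations. [folklore; Tao2019 §5] -/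
theorem stub_quietShell_noConcentration_false_without_NS : ¬ StubQ234WithoutNS :=
  Theorems.TypeITraceScarL3.Negative.stub_quietShell_noConcentration_false_without_NS

/-! ### (iii) s25-3 typed: exterior backward uniqueness with Type-I coefficients -/

/-- The exterior slab `]−1,0[ × (closedBall 0 R)ᶜ`. [folklore] -/
def extSlab (R : ℝ) : Set (ℝ × ℝ³) := Ioo (-1 : ℝ) 0 ×ˢ (closedBall (0 : ℝ³) R)ᶜ

theorem isOpen_extSlab (R : ℝ) : IsOpen (extSlab R) :=
  isOpen_Ioo.prod isClosed_closedBall.isOpen_compl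

/-- **s25-3, abstract layer.** Backward uniqueness across `s = 0` for the parabolic INEQUALITY
`|∂ₛw − Δw| ≤ (C/(−s))|w| + (C/√(−s))|∇w|` on the exterior slab, for bounded `w` with null top — the
verbatim transfer of ESS 2003 Thm 5.1 (there: bounded coefficients `M(|w| + |∇w|)`) to the scale-critical
coefficients that the vorticity equation `∂ₛω − Δω = ω·∇U − U·∇ω` of a Type-I apex has (`|∇U| ≤ C/(−s)`,
`|U| ≤ C/√(−s)`).  FALSE, see `abstractBUTypeIZeroOrder_false`. [cite: EscauriazaSereginSverak2003, Thm 5.1] -/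
def AbstractBUTypeIZeroOrder : Prop :=
  ∀ (R C : ℝ) (w : ℝ → ℝ³ → ℝ), 0 < R → 0 ≤ C →
    ContDiffOn ℝ 2 (uncurry w) (extSlab R) →
    (∀ s ∈ Ioo (-1 : ℝ) 0, ∀ y ∈ (closedBall (0 : ℝ³) R)ᶜ,
      |deriv (fun σ => w σ y) s - (Δ (w s)) y| ≤
        C / (-s) * |w s y| + C / Real.sqrt (-s) * ‖gradient (w s) y‖) →
    (∀ s ∈ Ioo (-1 : ℝ) 0, ∀ y ∈ (closedBall (0 : ℝ³) R)ᶜ, |w s y| ≤ C) →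
    (∀ y ∈ (closedBall (0 : ℝ³) R)ᶜ, Tendsto (fun s => w s y) (𝓝[<] 0) (𝓝 0)) →
    ∀ s ∈ Ioo (-1 : ℝ) 0, ∀ y ∈ (closedBall (0 : ℝ³) R)ᶜ, w s y = 0

/-- A point of `ℝ³` at distance `2` from the origin. [folklore] -/
def farPoint : ℝ³ := (2 : ℝ) • parasiticDir

theorem norm_farPoint : ‖farPoint‖ = 2 := by
  rw [farPoint, norm_smul, norm_parasiticDir, mul_one, Real.norm_eq_abs, abs_two]

theorem farPoint_mem {R : ℝ} (hR : R < 2) : farPoint ∈ (closedBall (0 : ℝ³) R)ᶜ := by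
  rw [mem_compl_iff, mem_closedBall, dist_zero_right, norm_farPoint, not_le]
  exact hR

/-- **(F-a) The abstract Type-I backward uniqueness is FALSE**: `w(s, y) = −s` is smooth, bounded by `1`,
tends to `0` as `s → 0⁻`, satisfies `|∂ₛw − Δw| = 1 = (1/(−s))|w|`, and is not zero.  The zeroth-order
coefficient `C/(−s)` is critical: no Carleman estimate insensitive to the structure of the right-hand side can
prove the exterior step for a Type-I apex. [folklore] -/
theorem abstractBUTypeIZeroOrder_false : ¬ AbstractBUTypeIZeroOrder := by
  intro h
  have hw := h 1 1 (fun s _ => -s) one_pos zero_le_one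
    (contDiff_fst.neg.contDiffOn) ?_ ?_ ?_ (-(1 / 2 : ℝ)) ⟨by norm_num, by norm_num⟩ farPoint
    (farPoint_mem (by norm_num))
  · norm_num at hw
  · intro s hs y _
    have hd : deriv (fun σ : ℝ => -σ) s = -1 := by
      rw [deriv_neg]
    have hΔ : (Δ (fun _ : ℝ³ => -s)) y = 0 := by
      rw [InnerProductSpace.laplacian_const]; rfl
    have hg : gradient (fun _ : ℝ³ => -s) y = 0 := gradient_fun_const _ _
    have hs0 : 0 < -s := by linarith [hs.2]
    rw [hd, hΔ, hg, norm_zero, mul_zero, add_zero, abs_of_pos hs0, sub_zero,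
      show |(-1 : ℝ)| = 1 by norm_num, one_div, inv_mul_cancel₀ hs0.ne']
  · intro s hs y _
    rw [abs_of_pos (by linarith [hs.2])]
    linarith [hs.1]
  · intro y _
    have : Tendsto (fun s : ℝ => -s) (𝓝 0) (𝓝 (-0)) := tendsto_neg (0 : ℝ)
    rw [neg_zero] at this
    exact this.mono_left nhdsWithin_le_nhds

/-- **s25-3, velocity layer.** «A classical Navier–Stokes flow on the exterior slab `]−1,0[ × (closedBall 0 R)ᶜ`
with the Type-I rate, IRROTATIONAL there, whose top is weakly null on the exterior, vanishes.»  FALSE, see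
`exteriorVelocityBUTypeI_false`: velocity backward uniqueness needs the equations ACROSS the core (or a flux
condition), exactly as for route item `ScarRigidity` (stmt-11717, `PotentialFlowParabolicExterior.lean`).
[cite: Serrin1962, the example u = a(t)∇h] -/
def ExteriorVelocityBUTypeI : Prop :=
  ∀ (R C : ℝ) (U : ℝ → ℝ³ → ℝ³) (P : ℝ → ℝ³ → ℝ), 1 ≤ R →
    IsClassicalNSSolutionOnRegion (extSlab R) 1 0 U P →
    (∀ s ∈ Ioo (-1 : ℝ) 0, ∀ y ∈ (closedBall (0 : ℝ³) R)ᶜ, ‖U s y‖ ≤ C / Real.sqrt (-s)) →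
    (∀ φ : ℝ³ → ℝ³, ContDiff ℝ (⊤ : ℕ∞) φ → HasCompactSupport φ →
      tsupport φ ⊆ (closedBall (0 : ℝ³) R)ᶜ → ∀ ε : ℝ, 0 < ε →
      ∃ s₀ : ℝ, s₀ < 0 ∧ ∀ s ∈ Ioo s₀ 0, |∫ y, ⟪U s y, φ y⟫| ≤ ε) →
    ∀ s ∈ Ioo (-1 : ℝ) 0, ∀ y ∈ (closedBall (0 : ℝ³) R)ᶜ, U s y = 0

/-- The exterior slab over `R ≥ 0` lies in the parabolic exterior `Ω_R = {R√(−t) < ‖x‖}` of the tree. [folklore] -/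
theorem extSlab_subset_parabolicExterior {R : ℝ} (hR : 0 ≤ R) : extSlab R ⊆ parabolicExterior R := by
  rintro ⟨t, x⟩ ⟨⟨ht1, ht2⟩, hx⟩
  rw [mem_compl_iff, mem_closedBall, dist_zero_right, not_le] at hx
  refine ⟨ht2, ?_⟩
  have hs : Real.sqrt (-t) ≤ 1 := by
    rw [Real.sqrt_le_one]; linarith
  calc R * Real.sqrt (-t) ≤ R * 1 := by gcongr
    _ = R := mul_one R
    _ < ‖x‖ := hx

/-- **(F-b) Exterior VELOCITY backward uniqueness with the Type-I rate is FALSE**: Serrin's potential flow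
`u = √(−s)∇Γ(y)` (tree `dipoleFlow 1`) is a classical Navier–Stokes flow on `]−1,0[ × (closedBall 0 1)ᶜ` with
`‖u‖ ≤ √(−s)/(4π) ≤ 1/√(−s)`, top null even uniformly (`‖u(s)‖_∞ → 0`), and `u ≠ 0`. [cite: Serrin1962, the example u = a(t)∇h] -/
theorem exteriorVelocityBUTypeI_false : ¬ ExteriorVelocityBUTypeI := by
  intro h
  have hsub : extSlab 1 ⊆ parabolicExterior 1 := extSlab_subset_parabolicExterior zero_le_one
  have hcl : IsClassicalNSSolutionOnRegion (extSlab 1) 1 0 (dipoleFlow 1) (dipoleFlowPressure 1) :=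
    (dipoleFlow_isClassical 1 zero_le_one).mono_of_isOpen hsub (isOpen_extSlab 1)
  have hrate : ∀ s ∈ Ioo (-1 : ℝ) 0, ∀ y ∈ (closedBall (0 : ℝ³) (1 : ℝ))ᶜ,
      ‖dipoleFlow 1 s y‖ ≤ 1 / Real.sqrt (-s) := by
    intro s hs y hy
    rw [mem_compl_iff, mem_closedBall, dist_zero_right, not_le] at hy
    have hy0 : y ≠ 0 := by
      rintro rfl; rw [norm_zero] at hy; linarith
    have hσ : 0 < Real.sqrt (-s) := Real.sqrt_pos.2 (by linarith [hs.2])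
    have hσ1 : Real.sqrt (-s) ≤ 1 := by rw [Real.sqrt_le_one]; linarith [hs.1]
    have hπ : (3 : ℝ) < Real.pi := Real.pi_gt_three
    rw [norm_dipoleFlow 1 hy0, abs_one, one_mul, le_div_iff₀ hσ]
    have h1 : Real.sqrt (-s) * (4 * Real.pi * ‖y‖ ^ 2)⁻¹ * Real.sqrt (-s) =
        Real.sqrt (-s) ^ 2 / (4 * Real.pi * ‖y‖ ^ 2) := by
      rw [div_eq_mul_inv]; ring
    rw [h1, div_le_one (by positivity)]
    nlinarith
  have htop : ∀ φ : ℝ³ → ℝ³, ContDiff ℝ (⊤ : ℕ∞) φ → HasCompactSupport φ →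
      tsupport φ ⊆ (closedBall (0 : ℝ³) (1 : ℝ))ᶜ → ∀ ε : ℝ, 0 < ε →
      ∃ s₀ : ℝ, s₀ < 0 ∧ ∀ s ∈ Ioo s₀ 0, |∫ y, ⟪dipoleFlow 1 s y, φ y⟫| ≤ ε := by
    intro φ _ _ _ ε hε
    set K : ℝ := ∫ y, ⟪dipole y, φ y⟫ with hK
    have hkey : ∀ s, ∫ y, ⟪dipoleFlow 1 s y, φ y⟫ = Real.sqrt (-s) * K := by
      intro s
      have e : ∀ y, ⟪dipoleFlow 1 s y, φ y⟫ = Real.sqrt (-s) * ⟪dipole y, φ y⟫ := by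
        intro y
        rw [dipoleFlow, sqrtAmp, one_mul, real_inner_smul_left]
      simp_rw [e]
      exact integral_const_mul _ _
    set η : ℝ := ε / (|K| + 1) with hη
    have hη0 : 0 < η := by positivity
    refine ⟨-(min (1 / 2) (η ^ 2)), by
      have : 0 < min (1 / 2 : ℝ) (η ^ 2) := lt_min (by norm_num) (by positivity)
      linarith, fun s hs => ?_⟩
    rw [hkey, abs_mul, abs_of_nonneg (Real.sqrt_nonneg _)]
    have hs0 : 0 < -s := by linarith [hs.2]
    have hsη : -s < η ^ 2 := by
      have := hs.1
      have hmin : min (1 / 2 : ℝ) (η ^ 2) ≤ η ^ 2 := min_le_right _ _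
      linarith
    have hsq : Real.sqrt (-s) < η := by
      rw [Real.sqrt_lt' hη0]; exact hsη
    calc Real.sqrt (-s) * |K| ≤ η * |K| := by gcongr
      _ = ε * (|K| / (|K| + 1)) := by rw [hη]; ring
      _ ≤ ε * 1 := by
          gcongr
          rw [div_le_one (by positivity)]; linarith
      _ = ε := mul_one ε
  have hzero := h 1 1 (dipoleFlow 1) (dipoleFlowPressure 1) le_rfl hcl hrate htop (-(1 / 2 : ℝ))
    ⟨by norm_num, by norm_num⟩ farPoint (farPoint_mem (by norm_num))
  have hmem : ((-(1 / 2 : ℝ)), farPoint) ∈ parabolicExterior 1 :=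
    hsub ⟨⟨by norm_num, by norm_num⟩, farPoint_mem (by norm_num)⟩
  exact dipoleFlow_ne_zero one_ne_zero zero_le_one hmem hzero

/-- **s25-3 proper (T3-local), vorticity layer — OPEN, typed only.** A classical Navier–Stokes flow on the
exterior slab `]−1,0[ × (closedBall 0 R)ᶜ` with the Type-I bounds `‖U‖ ≤ C/√(−s)`, `‖∇U‖ ≤ C/(−s)` and weakly
null top on the exterior is IRROTATIONAL on a (possibly smaller) exterior slab.  With the standard «rate ⇒
smooth with Type-I derivative bounds on every sub-slab ]−δ,−ε[» this is hypothesis C1 of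
`no_spreadExtinctApex_of_C1` (p587698), hence Stub C.  ESS 2003 Thm 5.1 is the bounded-coefficient case;
`abstractBUTypeIZeroOrder_false` says the coefficient-blind Carleman route fails here, and
`exteriorVelocityBUTypeI_false` says the conclusion cannot be strengthened to `U = 0`.
[cite: EscauriazaSereginSverak2003, Thm 5.1; Seregin2014, §6.6] -/
def ExteriorVorticityBUTypeI : Prop :=
  ∀ (R C : ℝ) (U : ℝ → ℝ³ → ℝ³) (P : ℝ → ℝ³ → ℝ), 1 ≤ R →
    IsClassicalNSSolutionOnRegion (extSlab R) 1 0 U P →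
    (∀ s ∈ Ioo (-1 : ℝ) 0, ∀ y ∈ (closedBall (0 : ℝ³) R)ᶜ,
      ‖U s y‖ ≤ C / Real.sqrt (-s) ∧ ‖fderiv ℝ (U s) y‖ ≤ C / (-s)) →
    (∀ φ : ℝ³ → ℝ³, ContDiff ℝ (⊤ : ℕ∞) φ → HasCompactSupport φ →
      tsupport φ ⊆ (closedBall (0 : ℝ³) R)ᶜ → ∀ ε : ℝ, 0 < ε →
      ∃ s₀ : ℝ, s₀ < 0 ∧ ∀ s ∈ Ioo s₀ 0, |∫ y, ⟪U s y, φ y⟫| ≤ ε) →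
    ∃ R' : ℝ, R ≤ R' ∧ ∀ s ∈ Ioo (-1 : ℝ) 0, ∀ y ∈ (closedBall (0 : ℝ³) R')ᶜ, curl (U s) y = 0

/-- `ExteriorVorticityBUTypeI` with its Navier–Stokes clause (`IsClassicalNSSolutionOnRegion …`) dropped. -/
def ExteriorVorticityBUTypeIWithoutNS : Prop :=
  ∀ (R C : ℝ) (U : ℝ → ℝ³ → ℝ³) (_P : ℝ → ℝ³ → ℝ), 1 ≤ R →
    (∀ s ∈ Ioo (-1 : ℝ) 0, ∀ y ∈ (closedBall (0 : ℝ³) R)ᶜ,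
      ‖U s y‖ ≤ C / Real.sqrt (-s) ∧ ‖fderiv ℝ (U s) y‖ ≤ C / (-s)) →
    (∀ φ : ℝ³ → ℝ³, ContDiff ℝ (⊤ : ℕ∞) φ → HasCompactSupport φ →
      tsupport φ ⊆ (closedBall (0 : ℝ³) R)ᶜ → ∀ ε : ℝ, 0 < ε →
      ∃ s₀ : ℝ, s₀ < 0 ∧ ∀ s ∈ Ioo s₀ 0, |∫ y, ⟪U s y, φ y⟫| ≤ ε) →
    ∃ R' : ℝ, R ≤ R' ∧ ∀ s ∈ Ioo (-1 : ℝ) 0, ∀ y ∈ (closedBall (0 : ℝ³) R')ᶜ, curl (U s) y = 0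

/-- **Census for s25-3 (vorticity layer): the Navier–Stokes clause is load-bearing OUTRIGHT (kernel-checked,
`Negative/C1PrimeFalseWithoutNS`).**  The divergence-free travelling swirl along `c(s) = (−s)⁻¹e₀` obeys both
Type-I bounds everywhere (`C = 3/2 + 4L`, `L = sup|χ'|`), has a null top against every test field, and
`curl U(s,·)(c(s)) ≠ 0` beyond every radius at late `s ∈ ]−1,0[`: a proof of `ExteriorVorticityBUTypeI` must use
that `ω = curl U` solves the vorticity equation (not merely the Type-I size of `U, ∇U` and the null top).
[folklore; EscauriazaSereginSverak2003 §5] -/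
theorem exteriorVorticityBUTypeI_false_without_NS : ¬ ExteriorVorticityBUTypeIWithoutNS :=
  Theorems.TypeITraceScarL3.Negative.exteriorVorticityBUTypeI_false_without_NS

end Summit.NavierStokesRegularity.NavierStokesRegularity.Cruxes.TypeITraceScarL3.Disproof

end
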